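import Literature.GroupTheory.CombinatorialGroupTheory.CommutatorLengthNPMembership
import Literature.GroupTheory.CombinatorialGroupTheory.CommutatorLengthNPAssembly
import Literature.GroupTheory.CombinatorialGroupTheory.RandomSclFreeGroupProofs
import Literature.Computability.Complexity.CookReducibilityTransitive
import Literature.Computability.Complexity.FoldBricks
import Literature.Computability.Complexity.BitCodecs
import HarnessLib

/-!
# CL-`F_s` reduces to CL-`F_r` for `s ≤ r`: the rank in Heuer's theorem

[Heuer2020, Thm. 1] is stated for EVERY non-abelian free group, and the named fact
`Heuer2020_clNPComplete` (`CommutatorLengthNP.lean`) accordingly quantifies over all ranks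
`r ≥ 2`. The printed proof (loc. cit. §5 with §4.2) obtains the general rank from the binary case:
CBI is NP-complete "if `A` has four letters … we may assume that `A` just has two letters, else we
may restrict it accordingly" (proof of Thm. 3, p. 13), and Thm. 2 (ii) reduces CBI-`A` to
CL-`F(A)`. This file proves the rank step on the CL side, once and for all and by the standard
free-factor argument ([Heuer2020, Prop. 2.7]-type monotonicity of `cl`, here for the retract
`F_s ↪ F_r ↠ F_s`): for `0 < s ≤ r`,

* the free-factor embedding `ι : F_s → F_r` (letters `Fin.castLE`) satisfies
  `g ∈ [F_s, F_s] ↔ ι g ∈ [F_r, F_r]` and `cl(ι g) = cl(g)` (`rankWord_mem_commutator_iff`,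
  `commutatorLength_rankWord`; via the tree's `map_mem_commutator`, `commutatorLength_map_le` and
  the letter retraction `rankRetr`), hence `(ι w, k) ∈ clDecisionSet r ↔ (w, k) ∈ clDecisionSet s`;
* the recoding of instance strings `⟨code_s w, 1ᵏ⟩ ↦ ⟨code_r (ι w), 1ᵏ⟩` (pad each one-hot letter
  block with `r − s` zeros; non-codes go to the non-instance `[]`) is a polynomial-time function
  in the tree's `FP` string algebra (`CLNP.rankRed`, a block fold `foldLoop appF`, guarded by the
  instance-code test `CLNP.codeT` of `CommutatorLengthNPMembership.lean`), so
  **`clLanguage s ≤ₚ clLanguage r`** (`clLanguage_karpReducible`);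
* consequently NP-hardness in the Cook form climbs the rank
  (`clLanguage_hard_mono`, by `PolyTimeKarpReducible.turing_holds` and
  `polyTimeTuringReducible_trans_holds`), and **the named fact reduces to rank two**:
  `Heuer2020_clNPComplete_of_two` — given `clLanguage r ∈ NP` for all `r ≥ 2` (the membership
  conjunct, [Heuer2020, Cor. 2.5]) and `NP ⊆ P^{CL-F₂}` ([Heuer2020, Thm. 3 for the binary
  alphabet with Thm. 2 (ii)]), `Heuer2020_clNPComplete` holds; with the membership conjunct
  proved in `CommutatorLengthNPAssembly.lean` this becomes the equivalence
  `Heuer2020_clNPComplete_iff_two : Heuer2020_clNPComplete ↔ NP ⊆ P^{CL-F₂}`.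

No named facts are introduced; everything here is proved.

## References

* [Heuer2020] N. Heuer, *Computing commutator length is hard*, arXiv:2001.10230, §1 (CL-`G`),
  Prop. 2.7, Thm. 1, §5.
* [AroraBarakCC2009] S. Arora, B. Barak, *Computational Complexity: A Modern Approach*, CUP 2009,
  Def. 2.7 (Karp reductions), §1.3 (closure of polynomial time under composition and bounded loops).
* [LadnerLynchSelman1975] R. Ladner, N. Lynch, A. Selman, *A comparison of polynomial time
  reducibilities*, TCS 1 (1975), §2 (`≤ₘᴾ ⇒ ≤ᵀᴾ`, transitivity of `≤ᵀᴾ`).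
-/

noncomputable section

namespace Literature.GroupTheory.CombinatorialGroupTheory

open _root_.Computability Literature.Computability.Complexity Literature.Computability.Complexity.Brick
  Literature.Computability.Complexity.HashBricks Literature.Computability.Complexity.Plumb
  Literature.Computability.Complexity.OracleCompose Polynomial
open scoped Literature.Computability.Complexity.Notation

/-! ### The free factor `F_s ↪ F_r`: commutator subgroup and `cl` are preserved -/

section Group

variable {s r : ℕ}

/-- The letter embedding `Fin s → Fin r` for `s ≤ r`. [folklore] -/
def rankEmb (hsr : s ≤ r) : Fin s → Fin r := Fin.castLE hsr

/-- A letter retraction `Fin r → Fin s` of `rankEmb` (`0 < s`). [folklore] -/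
def rankRetr (hs : 0 < s) (r : ℕ) : Fin r → Fin s := fun j => if h : j.val < s then ⟨j, h⟩ else ⟨0, hs⟩

/-- `rankRetr ∘ rankEmb = id`. [folklore] -/
theorem rankRetr_comp_rankEmb (hs : 0 < s) (hsr : s ≤ r) : rankRetr hs r ∘ rankEmb hsr = id := by
  funext j
  simp [rankRetr, rankEmb, j.isLt]

/-- The induced map on words (letters re-indexed, signs kept). [folklore] -/
def rankWord (hsr : s ≤ r) (w : List (Fin s × Bool)) : List (Fin r × Bool) :=
  w.map fun x => (rankEmb hsr x.1, x.2)

/-- Length of the re-indexed word. [folklore] -/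
@[simp] theorem length_rankWord (hsr : s ≤ r) (w : List (Fin s × Bool)) :
    (rankWord hsr w).length = w.length := by
  simp [rankWord]

/-- Letters of the re-indexed word. [folklore] -/
theorem getElem_rankWord (hsr : s ≤ r) (w : List (Fin s × Bool)) {i : ℕ} (hi : i < (rankWord hsr w).length) :
    (rankWord hsr w)[i] = (rankEmb hsr (w[i]'(by simpa using hi)).1, (w[i]'(by simpa using hi)).2) := by
  simp [rankWord]

/-- The re-indexed word represents the image under the free-factor embedding. [folklore] -/
theorem mk_rankWord (hsr : s ≤ r) (w : List (Fin s × Bool)) :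
    FreeGroup.mk (rankWord hsr w) = FreeGroup.map (rankEmb hsr) (FreeGroup.mk w) := by
  rw [FreeGroup.map.mk]
  rfl

/-- The retraction undoes the embedding on the free groups. [folklore] -/
theorem map_rankRetr_map_rankEmb (hs : 0 < s) (hsr : s ≤ r) (g : FreeGroup (Fin s)) :
    FreeGroup.map (rankRetr hs r) (FreeGroup.map (rankEmb hsr) g) = g := by
  rw [FreeGroup.map.comp, rankRetr_comp_rankEmb, FreeGroup.map.id]

/-- **Commutator-subgroup membership is preserved and reflected** by the free-factor embedding.
[folklore] -/
theorem rankWord_mem_commutator_iff (hs : 0 < s) (hsr : s ≤ r) (w : List (Fin s × Bool)) :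
    FreeGroup.mk (rankWord hsr w) ∈ commutator (FreeGroup (Fin r)) ↔
      FreeGroup.mk w ∈ commutator (FreeGroup (Fin s)) := by
  rw [mk_rankWord]
  refine ⟨fun h => ?_, map_mem_commutator _⟩
  have h' := map_mem_commutator (FreeGroup.map (rankRetr hs r)) h
  rwa [map_rankRetr_map_rankEmb] at h'

/-- **`cl` is preserved** by the free-factor embedding (`cl` can only drop under homomorphisms,
and `F_s` is a retract; cf. [Heuer2020, Prop. 2.7]). [cite: Heuer2020, Prop. 2.7] -/
theorem commutatorLength_rankWord (hs : 0 < s) (hsr : s ≤ r) (w : List (Fin s × Bool))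
    (hw : FreeGroup.mk w ∈ commutator (FreeGroup (Fin s))) :
    commutatorLength (FreeGroup.mk (rankWord hsr w)) = commutatorLength (FreeGroup.mk w) := by
  rw [mk_rankWord]
  refine le_antisymm (commutatorLength_map_le _ hw) ?_
  have h := commutatorLength_map_le (FreeGroup.map (rankRetr hs r)) (map_mem_commutator (FreeGroup.map (rankEmb hsr)) hw)
  rwa [map_rankRetr_map_rankEmb] at h

/-- **Yes-instances correspond** under the free-factor embedding. [cite: Heuer2020, §1 (Definition CL-G)] -/
theorem rankWord_mem_clDecisionSet_iff (hs : 0 < s) (hsr : s ≤ r) (w : List (Fin s × Bool)) (k : ℕ) :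
    (rankWord hsr w, k) ∈ clDecisionSet r ↔ (w, k) ∈ clDecisionSet s := by
  simp only [mem_clDecisionSet_iff]
  constructor
  · rintro ⟨hm, hc⟩
    have hm' := (rankWord_mem_commutator_iff hs hsr w).1 hm
    exact ⟨hm', by rwa [commutatorLength_rankWord hs hsr w hm'] at hc⟩
  · rintro ⟨hm, hc⟩
    exact ⟨(rankWord_mem_commutator_iff hs hsr w).2 hm, by rwa [commutatorLength_rankWord hs hsr w hm]⟩

/-! ### Letter codes under the rank change: pad the one-hot block with `r - s` zeros -/

/-- Recoding of one letter block: keep the `s` one-hot bits, insert `r - s` zeros, keep the sign. [folklore] -/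
def recodeBlock (s r : ℕ) (B : List Bool) : List Bool :=
  B.take s ++ (List.replicate (r - s) false ++ B.drop s)

/-- The one-hot vector of an embedded letter is the old one-hot vector padded with zeros. [folklore] -/
theorem ofFn_rankEmb_eq (hsr : s ≤ r) (a : Fin s) :
    List.ofFn (fun j : Fin r => decide (rankEmb hsr a = j)) =
      List.ofFn (fun j : Fin s => decide (a = j)) ++ List.replicate (r - s) false := by
  apply List.ext_getElem
  · simp; omega
  · intro i h1 h2
    rw [List.getElem_ofFn]
    by_cases hi : i < s
    · rw [List.getElem_append_left (by simpa using hi), List.getElem_ofFn]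
      simp only [rankEmb, Fin.ext_iff, Fin.val_castLE]
    · rw [List.getElem_append_right (by simpa using hi), List.getElem_replicate]
      simp only [rankEmb, Fin.ext_iff, Fin.val_castLE, decide_eq_false_iff_not]
      have := a.isLt
      omega

/-- **The recoded letter code is the letter code of the embedded letter.** [folklore] -/
theorem recodeBlock_clLetterCode (hsr : s ≤ r) (x : Fin s × Bool) :
    recodeBlock s r (clLetterCode s x) = clLetterCode r (rankEmb hsr x.1, x.2) := by
  unfold recodeBlock clLetterCode
  have hl : (List.ofFn fun j : Fin s => decide (x.1 = j)).length = s := by simp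
  rw [List.take_append_of_le_length hl.ge, List.take_of_length_le hl.le,
    List.drop_append_of_le_length hl.ge, List.drop_of_length_le hl.le, List.nil_append,
    ofFn_rankEmb_eq hsr x.1, List.append_assoc]

end Group

/-! ### The recoding machine -/

namespace CLNP

variable (s r : ℕ)

/-- On a record `⟨x, 1ʲ⟩`: the recoded `j`-th letter block of the instance `x`. [folklore] -/
def rcBlk : List Bool → List Bool :=
  appF ∘ fanoutFn (takeFn ∘ fanoutFn (fun _ => ones s) (blkAt s))
    (appF ∘ fanoutFn (fun _ => List.replicate (r - s) false) (dropFn ∘ fanoutFn (fun _ => ones s) (blkAt s)))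

/-- `rcBlk ∈ FP`. [cite: AroraBarakCC2009, §1.3] -/
theorem rcBlk_mem_FP : rcBlk s r ∈ FP :=
  comp_mem_FP appF_mem_FP (fanoutFn_mem_FP
    (comp_mem_FP takeFn_mem_FP (fanoutFn_mem_FP (const_mem_FP _) (blkAt_mem_FP s)))
    (comp_mem_FP appF_mem_FP (fanoutFn_mem_FP (const_mem_FP _)
      (comp_mem_FP dropFn_mem_FP (fanoutFn_mem_FP (const_mem_FP _) (blkAt_mem_FP s))))))

/-- Value of `rcBlk`: the recoded block. [folklore] -/
theorem rcBlk_apply (z : List Bool) : rcBlk s r z = recodeBlock s r (blkAt s z) := by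
  simp [rcBlk, recodeBlock]

/-- A block has at most `s + 1` symbols, on every input. [folklore] -/
theorem length_blkAt_le (z : List Bool) : (blkAt s z).length ≤ s + 1 := by
  simp [blkAt]

/-- Growth of `rcBlk`: at most `r + 1` symbols (for `s ≤ r`; in general `≤ max r s + 1`). [folklore] -/
theorem length_rcBlk_le (z : List Bool) : (rcBlk s r z).length ≤ (r + s + 1) * ((fstF z).length + 1) := by
  rw [rcBlk_apply, recodeBlock, List.length_append, List.length_append, List.length_take, List.length_drop,
    List.length_replicate]
  have h0 := length_blkAt_le s z
  have h1 : min s (blkAt s z).length ≤ s := min_le_left _ _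
  have h2 : r - s ≤ r := Nat.sub_le _ _
  have h3 : (blkAt s z).length - s ≤ 1 := by omega
  calc min s (blkAt s z).length + (r - s + ((blkAt s z).length - s)) ≤ r + s + 1 := by omega
    _ ≤ (r + s + 1) * ((fstF z).length + 1) := Nat.le_mul_of_pos_right _ (Nat.succ_pos _)

/-- **On `x`: the recoded word** — the concatenation of the recoded blocks `j < |W|/(s+1)`. [folklore] -/
def rcW : List Bool → List Bool :=
  sndPow 2 ∘ foldLoop appF (rcBlk s r) X ∘ fanoutFn id (fanoutFn (lenBinF ∘ nU s) fun _ => boolPair [] [])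

/-- **`rcW ∈ FP`** (a bounded concatenation loop). [cite: AroraBarakCC2009, §1.3 (bounded loops)] -/
theorem rcW_mem_FP : rcW s r ∈ FP :=
  comp_mem_FP (sndPow_mem_FP 2) (comp_mem_FP
    (foldLoop_mem_FP appF_mem_FP length_appF_le (rcBlk_mem_FP s r) (length_rcBlk_le s r) X)
    (fanoutFn_mem_FP id_mem_FP (fanoutFn_mem_FP (comp_mem_FP lenBinF_mem_FP (nU_mem_FP s)) (const_mem_FP _))))

variable {s r}

/-- The word code of the re-indexed word is the concatenation of the recoded letter codes. [folklore] -/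
theorem take_drop_clWordCode_rankWord (hsr : s ≤ r) (w : List (Fin s × Bool)) {j : ℕ} (hj : j < w.length) :
    ((clWordCode r (rankWord hsr w)).drop (j * (r + 1))).take (r + 1) = recodeBlock s r (clLetterCode s w[j]) := by
  rw [take_drop_clWordCode r (rankWord hsr w) j (by simpa using hj), getElem_rankWord,
    recodeBlock_clLetterCode hsr]

/-- **Value of `rcW` on an instance code**: the word code of the re-indexed word. [folklore] -/
theorem rcW_code (hsr : s ≤ r) (w : List (Fin s × Bool)) (k : ℕ) :
    rcW s r (clInstanceCode s (w, k)) = clWordCode r (rankWord hsr w) := by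
  set x := clInstanceCode s (w, k) with hx
  have hinit : fanoutFn id (fanoutFn (lenBinF ∘ nU s) fun _ => boolPair [] []) x =
      boolPair x (boolPair (encodeNat w.length) (boolPair (ones 0) [])) := by
    simp [hx, ones, nU_code]
  have hlen : w.length ≤ X.eval x.length := by
    rw [eval_X]
    have h1 := length_fstF_sndF_le x
    have h2 : (fstF x).length = (s + 1) * w.length := by rw [hx, fstF_code, length_clWordCode]
    nlinarith
  rw [rcW, Function.comp_apply, Function.comp_apply, hinit, foldLoop_apply appF (rcBlk s r) hlen 0 [],
    sndPow_succ_boolPair, sndPow_succ_boolPair, sndPow_zero_boolPair, foldAcc_appF, List.nil_append]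
  have hW : (clWordCode r (rankWord hsr w)).length = w.length * (r + 1) := by
    rw [length_clWordCode, length_rankWord, Nat.mul_comm]
  rw [← BitCodec.ccat_of_blocks hW]
  refine ccat_congr fun j hj => ?_
  rw [Nat.zero_add, rcBlk_apply, hx, blkAt_boolPair, List.length_replicate, fstF_code,
    take_drop_clWordCode s w j hj, take_drop_clWordCode_rankWord hsr w hj]

variable (s r)

/-- **The reduction function**: on an instance code, recode the word and keep the unary threshold;
anything else goes to the non-instance `[]`. [folklore] -/
def rankRed : List Bool → List Bool := iteFn (codeT s) (fanoutFn (rcW s r) sndF) fun _ => []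

/-- **`rankRed ∈ FP`.** [cite: AroraBarakCC2009, §1.3] -/
theorem rankRed_mem_FP : rankRed s r ∈ FP :=
  iteFn_mem_FP (codeT_mem_FP s) (fanoutFn_mem_FP (rcW_mem_FP s r) sndF_mem_FP) (const_mem_FP _)

variable {s r}

/-- Value of the reduction on an instance code. [folklore] -/
theorem rankRed_code (hsr : s ≤ r) (w : List (Fin s × Bool)) (k : ℕ) :
    rankRed s r (clInstanceCode s (w, k)) = clInstanceCode r (rankWord hsr w, k) := by
  rw [rankRed, iteFn_apply_true ((codeT_true_iff s _).2 ⟨w, k, rfl⟩), fanoutFn_apply, rcW_code hsr,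
    sndF_code]
  simp [clInstanceCode, ones, OracleCompose.unaryEncodeNat_eq_replicate]

/-- Value of the reduction off the instance codes. [folklore] -/
theorem rankRed_of_ne (x : List Bool) (hx : codeT s x ≠ [true]) : rankRed s r x = [] := by
  rw [rankRed, iteFn_of_oneBit (oneBit_codeT s), if_neg hx]

end CLNP

/-! ### The Karp reduction and its consequences for the named fact -/

/-- **CL-`F_s` Karp-reduces to CL-`F_r` for `0 < s ≤ r`.** [cite: Heuer2020, Prop. 2.7 and §5] -/
theorem clLanguage_karpReducible {s r : ℕ} (hs : 0 < s) (hsr : s ≤ r) : clLanguage s ≤ₚ clLanguage r := by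
  refine polyTimeKarpReducible_iff.2 ⟨CLNP.rankRed s r, CLNP.rankRed_mem_FP s r, fun x => ?_⟩
  by_cases hx : CLNP.codeT s x = [true]
  · obtain ⟨w, k, rfl⟩ := (CLNP.codeT_true_iff s x).1 hx
    rw [CLNP.rankRed_code hsr, clInstanceCode_mem_clLanguage_iff, clInstanceCode_mem_clLanguage_iff,
      rankWord_mem_clDecisionSet_iff hs hsr]
  · rw [CLNP.rankRed_of_ne x hx]
    constructor
    · rintro ⟨p, -, rfl⟩
      exact absurd ((CLNP.codeT_true_iff s _).2 ⟨p.1, p.2, rfl⟩) hx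
    · rintro ⟨p, -, h⟩
      exact absurd h (boolPair_ne_nil _ _)

/-- **NP-hardness in the Cook form climbs the rank**: if every `NP` language is polynomial-time
Turing-reducible to CL-`F_s` then also to CL-`F_r`, `0 < s ≤ r` (compose with the one-query
reduction `clLanguage s ≤ₚ clLanguage r`). [cite: LadnerLynchSelman1975, §2] -/
theorem clLanguage_hard_mono {s r : ℕ} (hs : 0 < s) (hsr : s ≤ r)
    (h : Nondeterministic.NP ⊆ PRel (Oracle.ofLanguage (clLanguage s))) :
    Nondeterministic.NP ⊆ PRel (Oracle.ofLanguage (clLanguage r)) := fun _ hL =>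
  polyTimeTuringReducible_trans_holds (h hL) (PolyTimeKarpReducible.turing_holds (clLanguage_karpReducible hs hsr))

/-- `P^{CL-F_s} ⊆ P^{CL-F_r}` for `0 < s ≤ r`. [cite: LadnerLynchSelman1975, §2] -/
theorem PRel_clLanguage_mono {s r : ℕ} (hs : 0 < s) (hsr : s ≤ r) :
    PRel (Oracle.ofLanguage (clLanguage s)) ⊆ PRel (Oracle.ofLanguage (clLanguage r)) := fun _ hL =>
  polyTimeTuringReducible_trans_holds hL (PolyTimeKarpReducible.turing_holds (clLanguage_karpReducible hs hsr))

/-- **The named fact reduces to rank two**: `Heuer2020_clNPComplete` follows from the membership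
conjunct `clLanguage r ∈ NP` (`r ≥ 2`, [Heuer2020, Cor. 2.5]) and the single hardness statement
`NP ⊆ P^{CL-F₂}` ([Heuer2020, Thm. 3 for the binary alphabet, with Thm. 2 (ii)]).
[cite: Heuer2020, Thm. 1 and §5] -/
theorem Heuer2020_clNPComplete_of_two
    (hNP : ∀ r : ℕ, 2 ≤ r → clLanguage r ∈ Nondeterministic.NP)
    (h₂ : Nondeterministic.NP ⊆ PRel (Oracle.ofLanguage (clLanguage 2))) : Heuer2020_clNPComplete :=
  fun r hr => ⟨hNP r hr, clLanguage_hard_mono two_pos hr h₂⟩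

/-- Conversely the fact contains the rank-two hardness statement (projection). [cite: Heuer2020, Thm. 1] -/
theorem Heuer2020_clNPComplete.hard_two (h : Heuer2020_clNPComplete) :
    Nondeterministic.NP ⊆ PRel (Oracle.ofLanguage (clLanguage 2)) :=
  (h 2 le_rfl).2

/-- **The named fact is equivalent to rank-two hardness**: `Heuer2020_clNPComplete ↔ NP ⊆ P^{CL-F₂}`
(membership for all ranks is proved, `clLanguage_mem_NP` of `CommutatorLengthNPAssembly.lean`;
hardness climbs the rank, `Heuer2020_clNPComplete_of_two`). What is left to formalise of
[Heuer2020, Thm. 1] is therefore exactly [Heuer2020, Thm. 3] for the binary alphabet (CBI-`{x,y}`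
is NP-hard) together with the Turing reduction CBI-`A` `≤ᵀₚ` CL-`F(A)` of [Heuer2020, Thm. 2 (ii)].
[cite: Heuer2020, Thm. 1 and §5] -/
theorem Heuer2020_clNPComplete_iff_two :
    Heuer2020_clNPComplete ↔ Nondeterministic.NP ⊆ PRel (Oracle.ofLanguage (clLanguage 2)) :=
  ⟨fun h => h.hard_two, fun h₂ => Heuer2020_clNPComplete_of_two (fun r _ => clLanguage_mem_NP r) h₂⟩

end Literature.GroupTheory.CombinatorialGroupTheory

end
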